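import Summits.KontsevichZagierPeriods.KontsevichZagierPeriods.Theorems.TerasomaMultiplicationBetaCancellationStubTameFormAux1

/-!
# `BetaCancellation` (stmt-KontsevichZagierPeriods-13633), line `divisor-slicing-transshipment` — stub `stub_tameForm`, auxiliary file 6: stabilisation of `MIso`

**Stabilisation of finite piecewise measure isomorphisms** (`MIso.restab`): an `MIso N σ ρ τ θ`
induces, for every `N ≤ N'`, an `MIso N'` between the stabilised families
`(stabSet h (σ i), stabFun h (ρ i))` and `(stabSet h (τ k), stabFun h (θ k))` — multiply every
piece and every map by the identity of the unit cube `(0,1)ᴺ'⁻ᴺ` (one coordinate at a time: the map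
`z ↦ (Ψ (init z), z_last)` has the block-diagonal derivative `w ↦ (Ψ' (init w), w_last)` of
determinant `det Ψ'`, `LinearMap.det_of_snoc_init`).

References: M. Kontsevich, D. Zagier, *Periods* (2001), §1.2; crux NOTES c6 (F13).
-/

noncomputable section

-- `Summit.KontsevichZagierPeriods.KontsevichZagierPeriods.…` is the tree's mandated layout (single-conjunct summit).
set_option linter.dupNamespace false

namespace Summit.KontsevichZagierPeriods.KontsevichZagierPeriods.BetaCancellationDivisorSlicing

open MeasureTheory Set Function
open Literature.NumberTheory.Transcendental
open Literature.NumberTheory.Transcendental.KZ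
open Literature.ModelTheory.ExponentialFields (IsSemialgebraic isSemialgebraic_univ)

variable {N : ℕ}

/-! ### One more coordinate -/

/-- Membership in a once-stabilised set: `init z ∈ S` and `z_last ∈ (0,1)`. [folklore] -/
theorem mem_stabSet_succ {S : Set (Fin N → ℝ)} {z : Fin (N + 1) → ℝ} :
    z ∈ stabSet N.le_succ S ↔ Fin.init z ∈ S ∧ z (Fin.last N) ∈ Ioo (0 : ℝ) 1 := by
  rw [mem_stabSet]
  refine and_congr Iff.rfl ⟨fun h => h (Fin.last N) le_rfl, fun h i hi => ?_⟩
  have : i = Fin.last N := Fin.ext (le_antisymm (Nat.lt_succ_iff.mp i.is_lt) hi)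
  rw [this]
  exact h

/-- A once-stabilised function is the function of `init`. [folklore] -/
theorem stabFun_succ_apply (f : (Fin N → ℝ) → ℝ) (z : Fin (N + 1) → ℝ) :
    stabFun N.le_succ f z = f (Fin.init z) :=
  rfl

/-- The linear map `init : ℝᴺ⁺¹ → ℝᴺ`. [folklore] -/
theorem initL_apply (w : Fin (N + 1) → ℝ) :
    (ContinuousLinearMap.pi fun i : Fin N => ContinuousLinearMap.proj (R := ℝ)
      (φ := fun _ : Fin (N + 1) => ℝ) (Fin.castSucc i)) w = Fin.init w :=
  rfl

/-- The block-diagonal extension `w ↦ (A (init w), w_last)` of a linear endomorphism `A` of `ℝᴺ`.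
[folklore] -/
theorem liftCLM_apply (A : (Fin N → ℝ) →L[ℝ] (Fin N → ℝ)) (w : Fin (N + 1) → ℝ) :
    (ContinuousLinearMap.pi (Fin.lastCases (motive := fun _ => (Fin (N + 1) → ℝ) →L[ℝ] ℝ)
      (ContinuousLinearMap.proj (Fin.last N))
      (fun i => (ContinuousLinearMap.proj i).comp (A.comp (ContinuousLinearMap.pi fun i : Fin N =>
        ContinuousLinearMap.proj (R := ℝ) (φ := fun _ : Fin (N + 1) => ℝ) (Fin.castSucc i)))))) w =
      Fin.snoc (A (Fin.init w)) (w (Fin.last N)) := by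
  funext i
  refine Fin.lastCases ?_ (fun j => ?_) i
  · simp
  · simp [initL_apply]

/-- The block-diagonal extension has the same determinant. [folklore] -/
theorem det_liftCLM (A : (Fin N → ℝ) →L[ℝ] (Fin N → ℝ)) :
    (ContinuousLinearMap.pi (Fin.lastCases (motive := fun _ => (Fin (N + 1) → ℝ) →L[ℝ] ℝ)
      (ContinuousLinearMap.proj (Fin.last N))
      (fun i => (ContinuousLinearMap.proj i).comp (A.comp (ContinuousLinearMap.pi fun i : Fin N =>
        ContinuousLinearMap.proj (R := ℝ) (φ := fun _ : Fin (N + 1) => ℝ) (Fin.castSucc i)))))).det =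
      A.det := by
  rw [ContinuousLinearMap.det]
  have h := LinearMap.det_of_snoc_init
    ((ContinuousLinearMap.pi (Fin.lastCases (motive := fun _ => (Fin (N + 1) → ℝ) →L[ℝ] ℝ)
      (ContinuousLinearMap.proj (Fin.last N))
      (fun i => (ContinuousLinearMap.proj i).comp (A.comp (ContinuousLinearMap.pi fun i : Fin N =>
        ContinuousLinearMap.proj (R := ℝ) (φ := fun _ : Fin (N + 1) => ℝ) (Fin.castSucc i))))) :
          (Fin (N + 1) → ℝ) →L[ℝ] (Fin (N + 1) → ℝ)) : (Fin (N + 1) → ℝ) →ₗ[ℝ] (Fin (N + 1) → ℝ))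
    (A : (Fin N → ℝ) →ₗ[ℝ] (Fin N → ℝ)) 0 1 (fun w => by
      rw [ContinuousLinearMap.coe_coe, liftCLM_apply]
      simp)
  rw [one_mul] at h
  exact h

namespace MIso

variable {ι κ : Type*} {σ : ι → Set (Fin N → ℝ)} {ρ : ι → (Fin N → ℝ) → ℝ}
  {τ : κ → Set (Fin N → ℝ)} {θ : κ → (Fin N → ℝ) → ℝ}

/-- **Stabilisation by one coordinate.** [folklore] -/
theorem restab_succ (m : MIso N σ ρ τ θ) :
    Nonempty (MIso (N + 1) (fun i => stabSet N.le_succ (σ i)) (fun i => stabFun N.le_succ (ρ i))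
      (fun k => stabSet N.le_succ (τ k)) (fun k => stabFun N.le_succ (θ k))) := by
  -- notation
  let initL : (Fin (N + 1) → ℝ) →L[ℝ] (Fin N → ℝ) :=
    ContinuousLinearMap.pi fun i : Fin N => ContinuousLinearMap.proj (R := ℝ)
      (φ := fun _ : Fin (N + 1) => ℝ) (Fin.castSucc i)
  let L : ((Fin N → ℝ) →L[ℝ] (Fin N → ℝ)) → ((Fin (N + 1) → ℝ) →L[ℝ] (Fin (N + 1) → ℝ)) := fun A =>
    ContinuousLinearMap.pi (Fin.lastCases (motive := fun _ => (Fin (N + 1) → ℝ) →L[ℝ] ℝ)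
      (ContinuousLinearMap.proj (Fin.last N))
      (fun i => (ContinuousLinearMap.proj i).comp (A.comp initL)))
  have hL : ∀ A w, L A w = Fin.snoc (A (Fin.init w)) (w (Fin.last N)) := fun A w => liftCLM_apply A w
  have hLdet : ∀ A, (L A).det = A.det := fun A => det_liftCLM A
  let Ψs : Fin m.J → (Fin (N + 1) → ℝ) → (Fin (N + 1) → ℝ) := fun j z =>
    Fin.snoc (m.Ψ j (Fin.init z)) (z (Fin.last N))
  have himage : ∀ j, Ψs j '' stabSet N.le_succ (m.P j) = stabSet N.le_succ (m.Ψ j '' m.P j) := by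
    intro j
    ext w
    simp only [mem_image, mem_stabSet_succ]
    constructor
    · rintro ⟨z, ⟨hz, hzl⟩, rfl⟩
      exact ⟨by simpa [Ψs] using mem_image_of_mem _ hz, by simpa [Ψs] using hzl⟩
    · rintro ⟨⟨y, hy, hyw⟩, hwl⟩
      refine ⟨Fin.snoc y (w (Fin.last N)), ⟨by simpa using hy, by simpa using hwl⟩, ?_⟩
      simp only [Ψs, Fin.init_snoc, Fin.snoc_last, hyw, Fin.snoc_init_self]
  refine of_fintype m.src m.tgt (fun j => stabSet N.le_succ (m.P j)) Ψs
    (fun j z => L (m.Ψ' j (Fin.init z))) (fun j => ?_) ?_ ?_ ?_ ?_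
  · obtain ⟨h1, h2, h3, h4, h5, h6, h7⟩ := m.piece j
    have hPs : IsSemialgebraic ℚ (stabSet N.le_succ (m.P j)) := isSemialgebraic_stabSet _ h1
    refine ⟨hPs, stabSet_mono _ h2, ?_, ?_, fun z hz => ?_, ?_, fun z hz => ?_⟩
    · -- semialgebraic map, coordinatewise
      refine (isSemialgebraicMapOn_iff_forall_holds hPs).mpr fun i => ?_
      refine Fin.lastCases ?_ (fun i' => ?_) i
      · exact (isSemialgebraicFunOn_aeval hPs (MvPolynomial.X (Fin.last N))).congr fun z _ => by
          simp [Ψs]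
      · have hc : IsSemialgebraicFunOn ℚ (m.P j) (fun y => m.Ψ j y i') :=
          (isSemialgebraicMapOn_iff_forall_holds h1).mp h3 i'
        exact (isSemialgebraicFunOn_stabFun_of_subset N.le_succ hc hPs
          (stabSet_subset_setOf _ _)).congr fun z _ => by
            simp only [Ψs, stabFun_apply, Fin.snoc_castSucc]
            rfl
    · -- injective
      rintro z ⟨hz, -⟩ z' ⟨hz', -⟩ hzz'
      have hi : m.Ψ j (Fin.init z) = m.Ψ j (Fin.init z') := by
        have := congrArg Fin.init hzz'
        simpa [Ψs] using this
      have hl : z (Fin.last N) = z' (Fin.last N) := by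
        have := congrFun hzz' (Fin.last N)
        simpa [Ψs] using this
      have hii : Fin.init z = Fin.init z' := h4 hz hz' hi
      rw [← Fin.snoc_init_self z, ← Fin.snoc_init_self z', hii, hl]
    · -- derivative within the stabilised piece
      rw [hasFDerivWithinAt_pi']
      intro i
      refine Fin.lastCases ?_ (fun i' => ?_) i
      · have hfun : (fun w => Ψs j w (Fin.last N)) = fun w => w (Fin.last N) := by
          funext w
          simp [Ψs]
        rw [hfun]
        refine ((ContinuousLinearMap.proj (R := ℝ) (φ := fun _ : Fin (N + 1) => ℝ)
          (Fin.last N)).hasFDerivAt).hasFDerivWithinAt.congr_fderiv ?_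
        ext w
        simp [hL]
      · have hfun : (fun w => Ψs j w (Fin.castSucc i')) = (fun y => m.Ψ j y i') ∘ initL := by
          funext w
          simp only [Ψs, Fin.snoc_castSucc, Function.comp_apply]
          rfl
        rw [hfun]
        have hcoord : HasFDerivWithinAt (fun y => m.Ψ j y i')
            ((ContinuousLinearMap.proj i').comp (m.Ψ' j (Fin.init z))) (m.P j) (Fin.init z) :=
          hasFDerivWithinAt_pi'.mp (h5 _ hz.1) i'
        have hinit : HasFDerivWithinAt initL initL (stabSet N.le_succ (m.P j)) z :=
          initL.hasFDerivAt.hasFDerivWithinAt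
        refine (hcoord.comp z hinit fun w hw => hw.1).congr_fderiv ?_
        ext w
        simp [hL, initL_apply, initL]
    · rw [himage]
      exact stabSet_mono _ h6
    · have h7' : ρ (m.src j) (Fin.init z) =
          θ (m.tgt j) (m.Ψ j (Fin.init z)) * |(m.Ψ' j (Fin.init z)).det| := h7 _ hz.1
      rw [stabFun_succ_apply, stabFun_succ_apply, h7', hLdet]
      simp [Ψs]
  · intro j j' hjj' h
    rw [← stabSet_inter]
    exact volume_stabSet_eq_zero _ (m.disjoint_src j j' hjj' h)
  · intro j j' hjj' h
    rw [himage, himage, ← stabSet_inter]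
    exact volume_stabSet_eq_zero _ (m.disjoint_tgt j j' hjj' h)
  · intro i
    refine measure_mono_null (fun z hz => ?_) (volume_stabSet_eq_zero N.le_succ (m.cover_src i))
    rw [mem_stabSet_succ]
    have hz1 := mem_stabSet_succ.mp hz.1
    refine ⟨⟨hz1.1, fun hmem => hz.2 ?_⟩, hz1.2⟩
    obtain ⟨j, hj, hzj⟩ : ∃ j, m.src j = i ∧ Fin.init z ∈ m.P j := by
      simpa only [mem_iUnion, exists_prop] using hmem
    exact mem_iUnion₂.mpr ⟨j, hj, mem_stabSet_succ.mpr ⟨hzj, hz1.2⟩⟩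
  · intro k
    refine measure_mono_null (fun w hw => ?_) (volume_stabSet_eq_zero N.le_succ (m.cover_tgt k))
    rw [mem_stabSet_succ]
    have hw1 := mem_stabSet_succ.mp hw.1
    refine ⟨⟨hw1.1, fun hmem => hw.2 ?_⟩, hw1.2⟩
    obtain ⟨j, hj, hwj⟩ : ∃ j, m.tgt j = k ∧ Fin.init w ∈ m.Ψ j '' m.P j := by
      simpa only [mem_iUnion, exists_prop] using hmem
    refine mem_iUnion₂.mpr ⟨j, hj, ?_⟩
    rw [himage]
    exact mem_stabSet_succ.mpr ⟨hwj, hw1.2⟩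

/-- **Stabilisation of a finite piecewise measure isomorphism** to any higher dimension. [folklore] -/
theorem restab {N' : ℕ} (h : N ≤ N') (m : MIso N σ ρ τ θ) :
    Nonempty (MIso N' (fun i => stabSet h (σ i)) (fun i => stabFun h (ρ i))
      (fun k => stabSet h (τ k)) (fun k => stabFun h (θ k))) := by
  induction N', h using Nat.le_induction with
  | base =>
    exact m.copy (funext fun i => stabSet_rfl _) (funext fun i => stabFun_rfl _)
      (funext fun k => stabSet_rfl _) (funext fun k => stabFun_rfl _)
  | succ N' h ih =>
    obtain ⟨m'⟩ := ih
    obtain ⟨m''⟩ := m'.restab_succ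
    exact m''.copy (funext fun i => (stabSet_stabSet h N'.le_succ _).symm)
      (funext fun i => (stabFun_stabFun h N'.le_succ _).symm)
      (funext fun k => (stabSet_stabSet h N'.le_succ _).symm)
      (funext fun k => (stabFun_stabFun h N'.le_succ _).symm)

end MIso

/-! ### Headline -/

/-- Registered helper goal of the stub `stub_tameForm`: stabilisation of finite piecewise measure
isomorphisms to higher dimension. [folklore] -/
theorem tameForm_aux_misoRestab : ∀ {N N' : ℕ} (h : N ≤ N') {ι κ : Type} {σ : ι → Set (Fin N → ℝ)} {ρ : ι → (Fin N → ℝ) → ℝ} {τ : κ → Set (Fin N → ℝ)} {θ : κ → (Fin N → ℝ) → ℝ}, MIso N σ ρ τ θ → Nonempty (MIso N' (fun i => stabSet h (σ i)) (fun i => stabFun h (ρ i)) (fun k => stabSet h (τ k)) (fun k => stabFun h (θ k))) :=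
  fun h _ _ _ _ _ _ m => m.restab h

end Summit.KontsevichZagierPeriods.KontsevichZagierPeriods.BetaCancellationDivisorSlicing

end
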